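import Summits.AtomisticToContinuum.Crystallization.Theorems.ChargedEnergyGapHarmonicTransfer
import HarnessLib

/-!
(SPLIT FOR THE 400-LINE CAP by the landing lane, hand-2 g29: this file = part A; part B = `…ChargedEnergyGapVolterraTransfer` imports it; same namespace, all FQNs unchanged.)
# `ChargedEnergyGap` — the VOLTERRA TRANSFER BOUND: quantised monodromy admitted as cut data, and the budget far leaf re-glued
LANDING BANNER (critic row 1115 (6); landing lane hand-2 g31): the (H𝄪)/(N𝄪)-type RECORD pieces of this lens-3 g53–g56 engine are VACUOUS at μ₀ > 0 — `harmStableWith_nonpos` (lens-3 g61, `…ChargedEnergyGapRotationGauge`); superseded by the …R designate ((H𝄪ʳ) `LocalSeamTransferBoundR`, (N𝄪ʳ) `LocalSeamReductionR` of `…ChargedEnergyGapRotationRepair`).  Landed as an ENGINE: the transfer / reduction lemmas below are consumed by P-I.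
# (cell `decomp-a2c`, lens 3, generation 54, node «VolterraTransfer», part P-B; over part P-A `…Theorems.ChargedEnergyGapHarmonicTransfer`)

WHAT P-A LEFT IDEA-NEEDED (memo g53 §3, critic row 1038).  The split CB-FAR_W|cored,B₀ ⟸ (H♭) ∧ (N♭) of part P-A tests the
profile-weighted harmonic model of the far account only on GLOBAL BOND COCYCLES `β₀ = A(z − y) + v z − v y` — bond fields with NO
monodromy.  A far region threaded by dislocation lines (cores centred, lines inside the free core zones, cut surfaces fanning out through
shell and plateau to other cores or periodically through the cell) is charted by a bond field that is flat OFF the lines but has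
QUANTISED HOLONOMY `b ∈ T(P)` (a translation preserving the reference point set) around them; such data were not test objects of (H♭),
so the reduction (N♭) was honestly IDEA-NEEDED on the whole dislocated sector.  Memo g53 §1 (dead end 10) also showed that monodromy
cannot be admitted by RELAXING the cocycle condition (bonds left free of a field are paid by the attractive tail per PLATEAU site, and
plateau/shell is unbounded): every bond, long or short, must be SLAVED to the data by a formula.

THE MOVE (one new test class, no new currency).  VOLTERRA CUT DATA: a finite family (per cell) of CUT PIECES — open planar parallelograms
`F = {base + a·edge₁ + b·edge₂ : 0 < a, b < 1}` with a normal `n ⟂ edge₁, edge₂`, a BURGERS VECTOR `b_F ∈ T(P) := {t : P.points + t =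
P.points}` and a planar in-radius `≥ r_S` — replicated by the period lattice `Λ_P`; the bond field under test is
  `β(y, z) = β₀(y, z) + J(y, z)`,  `J(y, z) = Σ_pieces Σ_{g ∈ Λ_P} [open segment (y, z) meets F + g] · sgn⟪z − y, n_F⟫ · b_F`
(`volterraField`; the inner sum is a `finsum`, genuinely finite: a bounded segment meets finitely many lattice translates of a bounded
piece), with `β₀` a global cocycle as in (H♭) (it carries the single-valued branch, discontinuities included — `v` is an arbitrary periodic
function) and with the SAME strain constraint `‖β(y, z)‖ ≤ τ·dist y z` on every non-excised pair.  Every bond is slaved (dead end 10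
honoured); `β` is flat on every site triangle not pierced by a piece RIM, and its holonomy around a rim is `±b_F` — quantised, so
`‖b_F‖ ≥ s`: there is no small-Burgers-vector regime.  DEGENERATE-WITNESS PASS (why the in-radius dial `r_S` is load-bearing, memo g54 §1):
a point-like or needle-like piece in general position is threaded by ONE chosen long bond and by no short bond, so it toggles a quantised
jump on that bond at no strain cost — finitely many such pieces per cell re-create the free long bonds of dead end 10 on the plateau and
the bound would be FALSE; a piece of planar in-radius `r_S = 3` anywhere outside the free core zones is threaded by nearest-neighbour
bonds on both sides of its rim, the strain constraint then forces the excision of a collar of sites along the rim (`‖b_F‖/(2πτ) ≈ 5`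
deep), and that collar is PRICED (`C_H` per site) unless it lies within `ϱ/8` of the centre set — so uncored dislocation content pays
for itself and cored content is exactly the physical sector the leaf must serve.  No condition ties the rims to the core zones: the
statement is simpler and STRONGER without it.  Cut pieces are crossed TRANSVERSALLY by site bonds (general position, a hypothesis on the
data: sites are countable, so honest cut surfaces can always be tilted off them), which makes `J` antisymmetric (`CutPiece.jump_swap`).

THE SPLIT (modus ponens, re-glued; generic in the weight system `W`; dials `s lam ℓ μ₀ τ λ ϱ C_T` of P-A, `r_S` new):
  (H♯) VOLTERRA-TRANSFER(C_T, r_S)  `VolterraTransferBoundC s lam ℓ μ₀ τ λ ϱ r_S C_T`: for every admissible reference `P` (separated,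
                           Barlow-labelled, force- and stress-free, harmonically stable with margin `μ₀` over global cocycles — verbatim
                           P-A), all `Λ_P`-invariant centre / excised sets `C, X`, every global cocycle `β₀` and every cut system `S` of
                           in-radius `≥ r_S` with `‖β₀ + J_S‖ ≤ τ·dist` on non-excised pairs:
                           `Σ_{y ∈ motif ∖ X} w_C(y)·(l_y(β) + λ·q_y(β)) ≥ −C_T·#shell − C_H·#priced` (`C_H ≥ 0` existential) —
                           STRONGER than (H♭) (`harmonicTransferBoundC_of_volterra`: the empty cut system), hence than (H) (the census
                           kill path of record stays valid: a refutation of (H) refutes (H♯)) · UNDECIDED → TRUE-leaning (memo g54 §2: in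
                           the shell annulus around a cored line the field is Volterra(b_net) + exact; the exact part is (H♭); the
                           Volterra part has linear terms — cut-surface `∇w`-moment `≈ 0.04` and branch-times-ghost-force `≈ 0.1` per unit
                           length — against the weighted shell share `≈ 1.2·λ·‖b‖²` of the line energy, `‖b‖ ≥ 0.97`; census C11-29, a
                           RELAXED cored hcp basal dislocation through the max-cover shell, holds `×28`) · INSTRUMENTABLE (ask C15: the
                           harmonic Volterra programme on the C11 geometry) · ATTACKABLE-M+ (P-A's weighted summation by parts plus the
                           cut-surface and branch terms of a flat connection with quantised holonomy);
  (N♯) VOLTERRA-REDUCTION_W  `VolterraReductionW … W c₁ ρ₀ B₀` := (H♯) ⟹ CB-FAR_W|cored,B₀ — WEAKER than (N♭) (`volterraReductionW_of_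
                           harmonicReduction`), hence than the leaf (`volterraReductionW_of_budget`) · UNDECIDED (TRUE-leaning with the
                           leaf for the max cover) · ATTACKABLE-L on every far region that is ONE periodic Barlow polytype up to elastic
                           distortion with ARBITRARY PERFECT-DISLOCATION CONTENT whose cores are centred (glide cuts re-pair reference
                           sites across the seam because `b ∈ T(P)`; prismatic components via glide cylinders; narrow dipoles cut the long
                           way round the cell, so `r_S = 3` costs no generality) and priced holes · IDEA-NEEDED only for REFERENCE SWITCHING:
                           fault ribbons of dissociated partials wider than the core zone (partial Burgers vectors `∉ T(P)`; census C14
                           decides whether LJ ribbons fit inside `ϱ/8 = 20`), grains, twins;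
  glue (proved)            (H♯) ∧ (N♯) ⟹ CB-FAR_W|cored,B₀ (`farLabelledFloorCoredBudgetW_of_volterra`).  (H♭) is NOT a third hypothesis
                           of the glue: it is implied by (H♯), so listing it would not be load-bearing; it stays in the DAG as the proved
                           corollary and kill path, and (N♭) ⟹ (N♯) records that the reduction got strictly easier.
WHY THIS IS NOVEL.  Monodromy enters an atomistic energy ACCOUNT inequality as QUANTISED CUT DATA on bonds — a flat lattice connection
with holonomy in the point-set stabiliser, every bond slaved by a crossing formula, the in-radius of the cut pieces as the one dial that
separates physical dislocation content (self-pricing through the strain constraint) from the free-long-bond artefact — whereas the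
atomistic dislocation literature (Ariza–Ortiz 2005 discrete dislocations via lattice complexes and integer-valued slip fields;
Hudson–Ortner 2014, Ehrlacher–Ortner–Shapeev 2016: predictor–corrector cell problems with the continuum Volterra field as predictor)
poses EXISTENCE / DECAY problems for equilibria with prescribed monodromy, never a uniform lower bound for a weighted account over all
monodromies, all cut systems and all centre sets with the shell-site count as the only currency.

§1 Cut pieces, the crossing jump, the Volterra bond field, degenerate instances (no pieces ⇒ `β = β₀`).  §2 Cut systems (planarity,
quantisation in `T(P)`, in-radius, transversality); the two pieces; ★ (H♯) ⟹ (H♭) ⟹ (H); (N♭) ⟹ (N♯); glue; WEAKER; dials incl. the new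
`r_S` dial.  §3 Record `(μ₀, τ, λ, r_S, C_T) = (1/100, 3/100, 1/2, 3, 1/(3·10⁶))`: ★★ the ten-leaf cone for every `W`, ★★ the max-cover
cone at `ϱ = 160`, the plausibility arithmetic of memo g54 §2.

TAGS.  VOLTERRA-TRANSFER(1/(3·10⁶), 3): UNDECIDED→TRUE-leaning · INSTRUMENTABLE (via (H): C10/C11/C13; directly: C15) · ATTACKABLE-M+ ·
STRONGER than (H♭) (proved).  VOLTERRA-REDUCTION_W: WEAKER than HARM-REDUCTION_W and than CB-FAR_W|cored,10⁵ (both proved) · UNDECIDED ·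
ATTACKABLE-L (single-polytype far regions with arbitrary centred perfect-dislocation content) | IDEA-NEEDED (reference switching: wide
fault ribbons, grains, twins).  No new EQUIV (the lineage's EQUIV of record stays `farLabelledFloorCoredW_iff_budget_packing`, part O-D). -/

noncomputable section

open scoped Classical
open Literature.MathematicalPhysics.StatisticalMechanics
open Literature.Geometry.DiscreteGeometry
open Summit.AtomisticToContinuum.Crystallization.Theses.PricedLinkCensus
open Summit.AtomisticToContinuum.Crystallization.Theorems.ChargedEnergyGapNegative

namespace Summit.AtomisticToContinuum.Crystallization.Theorems.ChargedEnergyGapChartDial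

/-! ## §1 Cut pieces, the crossing jump, the Volterra bond field -/

section Cuts

/-- A **CUT PIECE**: an (open) planar parallelogram `{base + a·edge₁ + b·edge₂ : 0 < a < 1, 0 < b < 1}` with a chosen normal
direction (orienting the crossing sign) and a BURGERS VECTOR (the jump a bond picks up when it crosses the piece along the normal). -/
structure CutPiece where
  /-- a corner of the parallelogram -/
  base : E3
  /-- first edge vector -/
  edge₁ : E3
  /-- second edge vector -/
  edge₂ : E3
  /-- the normal direction (planarity `n ⟂ edge₁, edge₂` is demanded by `IsCutSystem`) -/
  normal : E3
  /-- the Burgers vector (quantisation `∈ transSet P` is demanded by `IsCutSystem`) -/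
  burgers : E3

namespace CutPiece

variable (F : CutPiece)

/-- The OPEN parallelogram of the piece. -/
def carrier : Set E3 :=
  {q | ∃ a b : ℝ, 0 < a ∧ a < 1 ∧ 0 < b ∧ b < 1 ∧ q = F.base + a • F.edge₁ + b • F.edge₂}

/-- The CLOSED parallelogram of the piece (used only to state the in-radius condition). -/
def closedCarrier : Set E3 :=
  {q | ∃ a b : ℝ, 0 ≤ a ∧ a ≤ 1 ∧ 0 ≤ b ∧ b ≤ 1 ∧ q = F.base + a • F.edge₁ + b • F.edge₂}

/-- The piece translated by `g` (same edges, normal and Burgers vector). -/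
def shift (g : E3) : CutPiece :=
  ⟨F.base + g, F.edge₁, F.edge₂, F.normal, F.burgers⟩

/-- The bond `y → z` **CROSSES** the piece: the OPEN segment from `y` to `z` meets the open parallelogram. -/
def Crosses (y z : E3) : Prop :=
  ∃ q ∈ openSegment ℝ y z, q ∈ F.carrier

/-- The **JUMP** of the piece on the bond `y → z`: `± burgers` by the side of the normal the bond points to, if it crosses; else `0`. -/
def jump (y z : E3) : E3 :=
  if F.Crosses y z then (if 0 < inner ℝ (z - y) F.normal then F.burgers else -F.burgers) else 0

/-- The piece has PLANAR IN-RADIUS at least `ρ`: some disc of radius `ρ` of its plane `{q : ⟪q − base, n⟫ = 0}`, centred IN the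
plane, lies in the closed parallelogram (for `0 < ρ` this forces `n ≠ 0` and `edge₁, edge₂` independent: point-like and needle-like
pieces are excluded — the load-bearing exclusion, see the file header; the centre is pinned to the plane so that the condition is not
vacuous for a centre off it). -/
def HasInradius (ρ : ℝ) : Prop :=
  ∃ c : E3, inner ℝ (c - F.base) F.normal = 0 ∧
    ∀ q : E3, dist q c ≤ ρ → inner ℝ (q - F.base) F.normal = 0 → q ∈ F.closedCarrier

/-- Crossing is symmetric in the bond's ends (the open segment is). -/
theorem crosses_comm (y z : E3) : F.Crosses y z ↔ F.Crosses z y := by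
  simp only [Crosses, openSegment_symm ℝ y z]

/-- ★ For a TRANSVERSAL bond the jump is antisymmetric: `jump z y = −jump y z`. -/
theorem jump_swap {y z : E3} (h : F.Crosses y z → inner ℝ (z - y) F.normal ≠ 0) : F.jump z y = -F.jump y z := by
  by_cases hc : F.Crosses y z
  · have hc' : F.Crosses z y := (F.crosses_comm y z).1 hc
    have hne := h hc
    have hyz : inner ℝ (y - z) F.normal = -inner ℝ (z - y) F.normal := by
      rw [← inner_neg_left, neg_sub]
    simp only [jump, hc, hc', if_true, hyz]
    rcases lt_or_gt_of_ne hne with hlt | hgt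
    · rw [if_pos (by linarith), if_neg (not_lt.2 hlt.le), neg_neg]
    · rw [if_neg (by linarith), if_pos hgt]
  · have hc' : ¬F.Crosses z y := fun h' => hc ((F.crosses_comm y z).2 h')
    simp only [jump, hc, hc', if_false, neg_zero]

/-- A piece with zero Burgers vector never jumps. -/
theorem jump_of_burgers_eq_zero (h : F.burgers = 0) (y z : E3) : F.jump y z = 0 := by
  simp [jump, h]

/-- Shifting by `0` is the identity. -/
theorem shift_zero : F.shift 0 = F := by
  cases F; simp [shift]

end CutPiece

/-- The **STABILISER TRANSLATIONS** of the reference point set, `T(P) = {t : p + t ∈ P ↔ p ∈ P}` — the admissible (quantised)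
Burgers vectors; it contains the period lattice `Λ_P` (`mem_transSet_of_mem_lattice`) and, for the Barlow polytypes, the
full structure lattice. -/
def transSet (P : PeriodicConfiguration 3) : Set E3 :=
  {t | ∀ p : E3, p + t ∈ P.points ↔ p ∈ P.points}

/-- Period vectors are stabiliser translations. -/
theorem mem_transSet_of_mem_lattice {P : PeriodicConfiguration 3} {g : E3} (hg : g ∈ P.lattice) : g ∈ transSet P := by
  intro p
  refine ⟨fun h => ?_, fun h => P.add_mem_points h hg⟩
  have h' := P.add_mem_points h (P.lattice.neg_mem hg)
  simpa using h'

/-- `0` is a stabiliser translation (a piece may carry the trivial jump). -/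
theorem zero_mem_transSet (P : PeriodicConfiguration 3) : (0 : E3) ∈ transSet P :=
  mem_transSet_of_mem_lattice P.lattice.zero_mem

variable (P : PeriodicConfiguration 3) {k : ℕ} (S : Fin k → CutPiece)

/-- The **CUT JUMP** of a cut system of `k` pieces replicated by `Λ_P`, on the bond `y → z`: the sum over the pieces and over all
their lattice translates of the crossing jumps (the inner sum is a `finsum` — finitely many translates of a bounded piece meet a bounded
segment, so it is the honest sum). -/
def cutJump (y z : E3) : E3 :=
  ∑ i : Fin k, ∑ᶠ g : P.lattice, ((S i).shift (g : E3)).jump y z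

/-- The **VOLTERRA BOND FIELD** of the base cocycle `β₀` and the cut system `S`: `β = β₀ + J_S` — every bond slaved to the data. -/
def volterraField (β₀ : E3 → E3 → E3) : E3 → E3 → E3 :=
  fun y z => β₀ y z + cutJump P S y z

variable {P S}

/-- Degenerate instance: the EMPTY cut system has no jump … -/
theorem cutJump_fin_zero (S : Fin 0 → CutPiece) (y z : E3) : cutJump P S y z = 0 := by
  simp [cutJump]

/-- … so its Volterra field is the base cocycle itself ((H♯) ⟹ (H♭) runs through this). -/
theorem volterraField_fin_zero (S : Fin 0 → CutPiece) (β₀ : E3 → E3 → E3) : volterraField P S β₀ = β₀ := by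
  funext y z
  simp [volterraField, cutJump_fin_zero]

/-- A cut system all of whose Burgers vectors vanish has no jump either. -/
theorem cutJump_of_burgers_eq_zero (h : ∀ i, (S i).burgers = 0) (y z : E3) : cutJump P S y z = 0 := by
  refine Finset.sum_eq_zero fun i _ => ?_
  refine finsum_eq_zero_of_forall_eq_zero fun g => ?_
  exact CutPiece.jump_of_burgers_eq_zero _ (by simpa [CutPiece.shift] using h i) y z

end Cuts

end Summit.AtomisticToContinuum.Crystallization.Theorems.ChargedEnergyGapChartDial

end
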